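import Mathlib

/-!
# Cappell–Shaneson states are points of `ℙ¹ ∖ {0, 1, ∞}` and the fibre is forced (solo-blind s6)

Pure algebra behind `paper/cs-gompf-classes.md` §4c, R19 (solo seat `solo-SmoothPoincare4-blind`).

*Setting.* The Cappell–Shaneson matrices of trace `t` have characteristic polynomial
`f_t(x) = x³ - t x² + (t - 1) x - 1`.  A *state* of the Gompf move system on the fibre `t` is a pair
`(c, d)` with `d ∣ f_t(c)` — equivalently the cyclic ideal `⟨θ_t - c, d⟩` of `ℤ[θ_t]`, equivalently a ring
map `ℤ[θ_t] → ℤ/d`.  Gompf's log-transform move keeps `(c mod d, d)` and changes the trace by a multiple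
of `d`.

*Mathematics.* `f_t(x) = x (x - 1) (x + 1 - t) - 1` identically.  Hence, over any commutative ring `R`
(we use `R = ZMod d`), `f_t(c) = 0` iff `c (c - 1) (c + 1 - t) = 1`; so at a state `c` and `c - 1` are
units — the state is an `R`-point of `ℙ¹` minus the three cusps `0, 1, ∞` of the pencil — and the fibre
is FORCED: `t = c + 1 - (c (c - 1))⁻¹`.  Conversely every such point is a state on that fibre.  In
particular two traces carrying the same state are congruent mod `d` (`trace_modEq_of_state`), and
`f_{t+s}(c) = f_t(c) - s · c (c - 1)` is the algebra of the log-transform move.  The total space of the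
pencil `x (x - 1) (x + 1 - t) = 1` is `𝔸¹ ∖ {0, 1}`: `t` is the function `x + 1 - 1/(x(x-1))` on it.
-/

namespace Summit.SmoothPoincare4.SmoothPoincare4.Theorems

/-- The Cappell–Shaneson characteristic polynomial of trace `t`, evaluated at `c`. -/
def csCharPoly {R : Type*} [CommRing R] (t c : R) : R := c ^ 3 - t * c ^ 2 + (t - 1) * c - 1

/-- The cusp factorisation `f_t(c) = c (c - 1) (c + 1 - t) - 1`. -/
theorem csCharPoly_eq {R : Type*} [CommRing R] (t c : R) :
    csCharPoly t c = c * (c - 1) * (c + 1 - t) - 1 := by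
  unfold csCharPoly; ring

/-- The log-transform algebra: moving the trace by `s` changes `f_t(c)` by `-s · c (c - 1)`;
with `R = ZMod d` and `s = 0` in `R` this is `f_{t + j d}(c) ≡ f_t(c) (mod d)`. -/
theorem csCharPoly_add {R : Type*} [CommRing R] (t s c : R) :
    csCharPoly (t + s) c = csCharPoly t c - s * (c * (c - 1)) := by
  unfold csCharPoly; ring

/-- A state on the fibre `t`: `f_t(c) = 0` iff `c (c - 1) (c + 1 - t) = 1`. -/
theorem state_iff {R : Type*} [CommRing R] (t c : R) :
    csCharPoly t c = 0 ↔ c * (c - 1) * (c + 1 - t) = 1 := by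
  rw [csCharPoly_eq]
  constructor
  · intro h; linear_combination h
  · intro h; linear_combination h

/-- At a state the point `c` avoids the cusps: `c`, `c - 1` and `c (c - 1)` are units. -/
theorem isUnit_of_state {R : Type*} [CommRing R] {t c : R} (h : csCharPoly t c = 0) :
    IsUnit c ∧ IsUnit (c - 1) ∧ IsUnit (c * (c - 1)) := by
  rw [state_iff] at h
  refine ⟨IsUnit.of_mul_eq_one ((c - 1) * (c + 1 - t)) (show c * ((c - 1) * (c + 1 - t)) = 1 by
            linear_combination h),
          IsUnit.of_mul_eq_one (c * (c + 1 - t)) (show (c - 1) * (c * (c + 1 - t)) = 1 by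
            linear_combination h),
          IsUnit.of_mul_eq_one (c + 1 - t) h⟩

/-- The fibre is forced by the state: `t = c + 1 - u⁻¹` with `u = c (c - 1)`. -/
theorem fibre_eq_of_state {R : Type*} [CommRing R] {t c : R} (h : csCharPoly t c = 0) :
    ∃ u : Rˣ, (u : R) = c * (c - 1) ∧ t = c + 1 - ((u⁻¹ : Rˣ) : R) := by
  rw [state_iff] at h
  obtain ⟨u, hu⟩ := (IsUnit.of_mul_eq_one (c + 1 - t) h : IsUnit (c * (c - 1)))
  refine ⟨u, hu, ?_⟩
  have h1 : (u : R) * (c + 1 - t) = 1 := by rw [hu]; exact h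
  have hinv : ((u⁻¹ : Rˣ) : R) = c + 1 - t := by
    calc ((u⁻¹ : Rˣ) : R) = ((u⁻¹ : Rˣ) : R) * ((u : R) * (c + 1 - t)) := by rw [h1, mul_one]
      _ = c + 1 - t := by rw [← mul_assoc, Units.inv_mul, one_mul]
  rw [hinv]; ring

/-- Two fibres carrying the same state coincide in `R`. -/
theorem fibre_unique {R : Type*} [CommRing R] {t t' c : R}
    (h : csCharPoly t c = 0) (h' : csCharPoly t' c = 0) : t = t' := by
  rw [state_iff] at h h'
  have hu : IsUnit (c * (c - 1)) := IsUnit.of_mul_eq_one (c + 1 - t) h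
  have hz : c * (c - 1) * (t' - t) = 0 := by linear_combination h - h'
  have := hu.mul_right_eq_zero.mp hz
  linear_combination -this

/-- Conversely, every point of `ℙ¹ ∖ {0, 1, ∞}` (a `c` with `c (c - 1)` a unit) is a state on the forced fibre. -/
theorem state_of_point {R : Type*} [CommRing R] (c : R) (u : Rˣ) (hu : (u : R) = c * (c - 1)) :
    csCharPoly (c + 1 - ((u⁻¹ : Rˣ) : R)) c = 0 := by
  rw [state_iff]
  have : c + 1 - (c + 1 - ((u⁻¹ : Rˣ) : R)) = ((u⁻¹ : Rˣ) : R) := by ring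
  rw [this, ← hu, Units.mul_inv]

/-- Integer form: if `d ∣ f_t(c)` and `d ∣ f_{t'}(c)` then `t ≡ t' (mod d)` — the trace residue is a
function of the state, so along a Gompf-equivalence the traces visited by a fixed state `(c, d)` form
one residue class mod `d`. -/
theorem trace_modEq_of_state (d : ℕ) (t t' c : ℤ)
    (h : (d : ℤ) ∣ csCharPoly t c) (h' : (d : ℤ) ∣ csCharPoly t' c) : t ≡ t' [ZMOD d] := by
  have cast_eq : ∀ s : ℤ, ((csCharPoly s c : ℤ) : ZMod d) = csCharPoly (s : ZMod d) (c : ZMod d) := by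
    intro s; unfold csCharPoly; push_cast; ring
  have hz : csCharPoly (t : ZMod d) (c : ZMod d) = 0 := by
    rw [← cast_eq, (ZMod.intCast_zmod_eq_zero_iff_dvd _ d).mpr h]
  have hz' : csCharPoly (t' : ZMod d) (c : ZMod d) = 0 := by
    rw [← cast_eq, (ZMod.intCast_zmod_eq_zero_iff_dvd _ d).mpr h']
  exact (ZMod.intCast_eq_intCast_iff _ _ _).mp (fibre_unique hz hz')

/-- Integer form of the move algebra: `f_{t + j d}(c) ≡ f_t(c) (mod d)`, so `d ∣ f_t(c)` iff `d ∣ f_{t + j d}(c)`. -/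
theorem dvd_csCharPoly_add_mul_iff (d j t c : ℤ) :
    d ∣ csCharPoly (t + j * d) c ↔ d ∣ csCharPoly t c := by
  rw [csCharPoly_add]
  constructor
  · intro h
    have : csCharPoly t c = (csCharPoly t c - j * d * (c * (c - 1))) + d * (j * (c * (c - 1))) := by ring
    rw [this]; exact dvd_add h (dvd_mul_right d _)
  · intro h
    exact dvd_sub h (Dvd.intro (j * (c * (c - 1))) (by ring))

/-- Sanity instance: the stuck class `x = (37, 155)` lives on the traces `≡ 70 (mod 155)`. -/
example : (155 : ℤ) ∣ csCharPoly 70 37 := by unfold csCharPoly; norm_num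
example : ¬ (155 : ℤ) ∣ csCharPoly 71 37 := by unfold csCharPoly; norm_num

end Summit.SmoothPoincare4.SmoothPoincare4.Theorems
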